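import Literature.NumberTheory.Sieve.SingularSeries
import HarnessLib

/-!
# Ford–Green–Konyagin–Maynard–Tao 2018 — §6: an admissible `r`-tuple in `[1, 2r²]` and the choice
# `r = ⌊log^{1/5} x⌋` (PROVED)

Topic `Literature/NumberTheory/Sieve`. Source: K. Ford, B. Green, S. Konyagin, J. Maynard, T. Tao,
*Long gaps between primes*, J. Amer. Math. Soc. 31 (2018) 65–105 = arXiv:1412.5029, §6 p. 17
[FordGreenKonyaginMaynardTao2018]: «Let `r` be the maximum value permitted by Theorem 5, namely
(6.8) `r := ⌊log^{1/5} x⌋`, and let `h_1, …, h_r` be the admissible `r`-tuple consisting of the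
first `r` primes larger than `r`, thus `h_i = p_{π(r)+i}` … we have `h_i ∈ [2r²]` … one can take
any admissible `r`-tuple here with elements `h_i ≤ r^{100}` (e.g., `h_i = (2i − 1)^2` also works)».

Theorem 5 as typed (`FordGreenKonyaginMaynardTao2018_theorem5`) asks for an admissible `H` with
`H ⊆ [1, 2 (#H)²]`. This file PROVES that the explicit tuple
`FGKMT2018.sqShifts r = {2 j² : 1 ≤ j ≤ r}` qualifies (no prime-counting input is needed: all its
elements are even, and modulo an odd prime `p` the map `t ↦ 2t²` is not injective, so a residue
class is missed), that `#(sqShifts r) = r`, and the elementary facts about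
`FGKMT2018.shiftCount x = ⌊log^{1/5} x⌋` used in the deduction of Theorem 4 from Theorem 5.
-/

noncomputable section

open Finset Filter

namespace Literature.NumberTheory.Sieve

namespace FGKMT2018

/-- `H_r := {2 j² : 1 ≤ j ≤ r}`, an admissible `r`-tuple in `[1, 2r²]`.
[cite: FordGreenKonyaginMaynardTao2018, §6 p. 17] -/
def sqShifts (r : ℕ) : Finset ℤ :=
  (Finset.Icc (1 : ℤ) r).image fun j => 2 * j ^ 2

/-- [cite: FordGreenKonyaginMaynardTao2018, §6 p. 17] -/
theorem mem_sqShifts {r : ℕ} {h : ℤ} :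
    h ∈ sqShifts r ↔ ∃ j : ℤ, 1 ≤ j ∧ j ≤ r ∧ 2 * j ^ 2 = h := by
  simp [sqShifts, Finset.mem_image, Finset.mem_Icc, and_assoc]

/-- [cite: FordGreenKonyaginMaynardTao2018, §6 p. 17] -/
theorem sqShifts_injOn (r : ℕ) :
    Set.InjOn (fun j : ℤ => 2 * j ^ 2) (Finset.Icc (1 : ℤ) r : Set ℤ) := by
  intro a ha b hb hab
  simp only [Finset.coe_Icc, Set.mem_Icc] at ha hb
  have hsq : a ^ 2 = b ^ 2 := by
    have := hab
    simp only at this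
    linarith
  exact (pow_left_inj₀ (by linarith [ha.1]) (by linarith [hb.1]) two_ne_zero).1 hsq

/-- `#H_r = r`. [cite: FordGreenKonyaginMaynardTao2018, §6 p. 17] -/
theorem card_sqShifts (r : ℕ) : #(sqShifts r) = r := by
  rw [sqShifts, Finset.card_image_of_injOn (sqShifts_injOn r)]
  simp

/-- `H_r ⊆ [1, 2r²]` in the form required by Theorem 5. [cite: FordGreenKonyaginMaynardTao2018, §6 p. 17] -/
theorem sqShifts_bounds (r : ℕ) :
    ∀ h ∈ sqShifts r, 1 ≤ h ∧ h ≤ 2 * (#(sqShifts r) : ℤ) ^ 2 := by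
  intro h hh
  rw [card_sqShifts]
  obtain ⟨j, hj1, hjr, rfl⟩ := mem_sqShifts.1 hh
  refine ⟨by nlinarith, ?_⟩
  have : j ^ 2 ≤ (r : ℤ) ^ 2 := pow_le_pow_left₀ (by linarith) hjr 2
  linarith

/-- The elements of `H_r` are positive. [cite: FordGreenKonyaginMaynardTao2018, §6 p. 17] -/
theorem one_le_of_mem_sqShifts {r : ℕ} {h : ℤ} (hh : h ∈ sqShifts r) : 1 ≤ h :=
  ((sqShifts_bounds r) h hh).1

/-- **`H_r` is admissible**: modulo a prime `p` its image lies in `{2t² : t ∈ ℤ/p}`, which is a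
proper subset of `ℤ/p` since `t ↦ 2t²` identifies `1` and `−1` (and `0`, `1` when `p = 2`).
[cite: FordGreenKonyaginMaynardTao2018, §6 p. 17] -/
theorem isAdmissibleTuple_sqShifts (r : ℕ) : IsAdmissibleTuple (sqShifts r) := by
  classical
  intro p hp
  haveI : NeZero p := ⟨hp.ne_zero⟩
  unfold tupleResidueCount
  set g : ZMod p → ZMod p := fun t => 2 * t ^ 2 with hg
  have hsub : (sqShifts r).image (fun h : ℤ => (h : ZMod p)) ⊆
      (Finset.univ : Finset (ZMod p)).image g := by
    intro v hv
    obtain ⟨h, hh, rfl⟩ := Finset.mem_image.1 hv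
    obtain ⟨j, -, -, rfl⟩ := mem_sqShifts.1 hh
    refine Finset.mem_image.2 ⟨(j : ZMod p), Finset.mem_univ _, ?_⟩
    simp only [hg]
    push_cast
    ring
  refine lt_of_le_of_lt (Finset.card_le_card hsub) ?_
  have hle : #((Finset.univ : Finset (ZMod p)).image g) ≤ p := by
    calc #((Finset.univ : Finset (ZMod p)).image g)
          ≤ #(Finset.univ : Finset (ZMod p)) := Finset.card_image_le
      _ = p := by rw [Finset.card_univ, ZMod.card]
  refine lt_of_le_of_ne hle fun heq => ?_
  have hinj : Set.InjOn g ↑(Finset.univ : Finset (ZMod p)) := by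
    rw [← Finset.card_image_iff, heq, Finset.card_univ, ZMod.card]
  have h1 : g 1 = g (-1) := by simp [hg]
  have h11 : (1 : ZMod p) = -1 := hinj (by simp) (by simp) h1
  have h2 : ((2 : ℤ) : ZMod p) = 0 := by
    have : (2 : ZMod p) = 0 := by linear_combination h11
    exact_mod_cast this
  have hdvd : (p : ℤ) ∣ 2 := (ZMod.intCast_zmod_eq_zero_iff_dvd 2 p).1 h2
  have hp2 : p = 2 := by
    have h' : p ∣ 2 := by exact_mod_cast hdvd
    exact (Nat.prime_dvd_prime_iff_eq hp Nat.prime_two).1 h'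
  subst hp2
  have h01 : g 0 = g 1 := by
    simp only [hg]
    decide
  exact absurd (hinj (by simp) (by simp) h01) (by decide)

/-! ### `r = ⌊log^{1/5} x⌋` -/

/-- `r(x) := ⌊log^{1/5} x⌋` ((6.8′), «the maximum value permitted by Theorem 5»).
[cite: FordGreenKonyaginMaynardTao2018, §6 p. 17] -/
def shiftCount (x : ℕ) : ℕ := ⌊(Real.log x) ^ ((1 : ℝ) / 5)⌋₊

/-- [cite: FordGreenKonyaginMaynardTao2018, (6.1) p. 17] -/
theorem shiftCount_le (x : ℕ) : (shiftCount x : ℝ) ≤ (Real.log x) ^ ((1 : ℝ) / 5) :=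
  Nat.floor_le (Real.rpow_nonneg (Real.log_natCast_nonneg x) _)

/-- `r ≤ √(log x)` once `log x ≥ 1` (the size bound `#H ≤ √log x` of Theorem 4).
[cite: FordGreenKonyaginMaynardTao2018, (4.19) p. 12] -/
theorem shiftCount_le_sqrt {x : ℕ} (hx : 1 ≤ Real.log x) :
    (shiftCount x : ℝ) ≤ Real.sqrt (Real.log x) := by
  refine (shiftCount_le x).trans ?_
  rw [Real.sqrt_eq_rpow]
  exact Real.rpow_le_rpow_of_exponent_le hx (by norm_num)

/-- `r(x) → ∞`; in particular `r₀ ≤ r(x)` for all large `x`.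
[cite: FordGreenKonyaginMaynardTao2018, §6 p. 17] -/
theorem tendsto_shiftCount : Tendsto shiftCount atTop atTop :=
  tendsto_nat_floor_atTop.comp <|
    (tendsto_rpow_atTop (by norm_num)).comp <|
      Real.tendsto_log_atTop.comp tendsto_natCast_atTop_atTop

/-- [cite: FordGreenKonyaginMaynardTao2018, §6 p. 17] -/
theorem eventually_le_shiftCount (r₀ : ℕ) : ∀ᶠ x : ℕ in atTop, r₀ ≤ shiftCount x :=
  tendsto_shiftCount.eventually_ge_atTop r₀

/-- The tuple `H_{r(x)}` meets every requirement of Theorem 5 except `r₀ ≤ r` (which holds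
eventually, `eventually_le_shiftCount`): admissible, `#H ≤ log^{1/5} x`, `H ⊆ [1, 2(#H)²]`.
[cite: FordGreenKonyaginMaynardTao2018, §6 p. 17] -/
theorem sqShifts_shiftCount_spec (x : ℕ) :
    IsAdmissibleTuple (sqShifts (shiftCount x)) ∧
      (#(sqShifts (shiftCount x)) : ℝ) ≤ (Real.log x) ^ ((1 : ℝ) / 5) ∧
      (∀ h ∈ sqShifts (shiftCount x), 1 ≤ h ∧ h ≤ 2 * (#(sqShifts (shiftCount x)) : ℤ) ^ 2) := by
  refine ⟨isAdmissibleTuple_sqShifts _, ?_, sqShifts_bounds _⟩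
  rw [card_sqShifts]
  exact shiftCount_le x

end FGKMT2018

end Literature.NumberTheory.Sieve
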